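import Literature.Computability.QuantumComplexity.SolovayKitaev.Words
import Literature.MathematicalPhysics.QuantumLattice.GaugeGroups
import HarnessLib

/-!
# Solovay–Kitaev theorem: the initial net of words

Proof infrastructure for the discharge of
`Literature.Computability.QuantumComplexity.solovay_kitaev`.  Dawson–Nielsen (*The Solovay–Kitaev
algorithm*, QIC **6** (2006) §3, "basic approximation") start the recursion from an
`ε₀`-net of words of some fixed length `l₀`: "this preprocessing stage may be accomplished simply
by enumerating and storing a large number of instruction sequences from `𝒢`, say up to some
sufficiently large (but fixed) length `l₀`".  The existence of such an `l₀` is the content of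
`exists_length_forall_wordApprox` below: it follows from the density of the generated subgroup
(every element of which is a word, the instruction set being closed under inverses) and the
compactness of `SU(n)` (`Matrix.specialUnitaryGroup.instCompactSpace` from
`Literature.MathematicalPhysics.QuantumLattice.GaugeGroups`) by extracting a finite subcover from
the cover of `SU(n)` by the open `ε₀`-balls around all words.  Finiteness of the instruction set
is not needed for this step.  No definitions and no new statements are introduced.
-/

noncomputable section

open scoped Matrix.Norms.L2Operator

namespace Literature.Computability.QuantumComplexity.SolovayKitaev

open Matrix

variable {n : Type*} [Fintype n] [DecidableEq n]

/-- In a group, every element of the subgroup generated by an inverse-closed set `G` is the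
product of a list of elements of `G`. [folklore] -/
theorem exists_list_prod_eq_of_mem_closure {Γ : Type*} [Group Γ] {G : Set Γ}
    (hinv : ∀ g ∈ G, g⁻¹ ∈ G) {x : Γ} (hx : x ∈ Subgroup.closure G) :
    ∃ w : List Γ, (∀ g ∈ w, g ∈ G) ∧ w.prod = x := by
  have hx' : x ∈ (Subgroup.closure G).toSubmonoid := hx
  rw [Subgroup.closure_toSubmonoid] at hx'
  obtain ⟨l, hl, hprod⟩ := Submonoid.exists_list_of_mem_closure hx'
  refine ⟨l, fun g hg => ?_, hprod⟩
  rcases hl g hg with h | h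
  · exact h
  · have := hinv g⁻¹ (Set.mem_inv.1 h)
    rwa [inv_inv] at this

/-- **The basic approximation** (Dawson–Nielsen 2006 §3): if `G ⊆ SU(n)` is closed under inverses
and generates a dense subgroup, then for every `ε₀ > 0` there is a length `l₀` such that every
`U ∈ SU(n)` is within `ε₀` of a word of length `≤ l₀` over `G`.  (Density makes the open
`ε₀`-balls around words cover `SU(n)`; compactness extracts finitely many words.)
[cite: DawsonNielsen2006, §3] -/
theorem exists_length_forall_wordApprox {G : Set (Matrix.specialUnitaryGroup n ℂ)}
    (hinv : ∀ g ∈ G, g⁻¹ ∈ G)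
    (hdense : Dense (Subgroup.closure G : Set (Matrix.specialUnitaryGroup n ℂ)))
    {ε₀ : ℝ} (hε₀ : 0 < ε₀) :
    ∃ l₀ : ℕ, ∀ U : Matrix.specialUnitaryGroup n ℂ, WordApprox G l₀ ε₀ U := by
  -- the cover of `SU(n)` by the `ε₀`-balls around words
  let ι := {w : List (Matrix.specialUnitaryGroup n ℂ) // ∀ g ∈ w, g ∈ G}
  let c : ι → Set (Matrix.specialUnitaryGroup n ℂ) := fun w =>
    {U | ‖((w.1.prod : Matrix.specialUnitaryGroup n ℂ) : Matrix n n ℂ) - (U : Matrix n n ℂ)‖ < ε₀}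
  have hball : ∀ X : Matrix n n ℂ,
      IsOpen {U : Matrix.specialUnitaryGroup n ℂ | ‖X - (U : Matrix n n ℂ)‖ < ε₀} := by
    intro X
    have h : {U : Matrix.specialUnitaryGroup n ℂ | ‖X - (U : Matrix n n ℂ)‖ < ε₀} =
        Subtype.val ⁻¹' Metric.ball X ε₀ := by
      ext U
      simp only [Set.mem_setOf_eq, Set.mem_preimage, Metric.mem_ball, dist_eq_norm, norm_sub_rev]
    rw [h]
    exact Metric.isOpen_ball.preimage continuous_subtype_val
  have hopen : ∀ w : ι, IsOpen (c w) := fun w => hball _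
  have hcover : (Set.univ : Set (Matrix.specialUnitaryGroup n ℂ)) ⊆ ⋃ w : ι, c w := by
    intro U _
    -- a generated element within `ε₀` of `U`, written as a word
    have hO : IsOpen {V : Matrix.specialUnitaryGroup n ℂ | ‖(U : Matrix n n ℂ) - (V : Matrix n n ℂ)‖ < ε₀} :=
      hball _
    have hU : U ∈ {V : Matrix.specialUnitaryGroup n ℂ | ‖(U : Matrix n n ℂ) - (V : Matrix n n ℂ)‖ < ε₀} := by
      simp [hε₀]
    obtain ⟨V, hVmem, hVU⟩ := hdense.exists_mem_open hO ⟨U, hU⟩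
    obtain ⟨w, hw, hprod⟩ := exists_list_prod_eq_of_mem_closure hinv (SetLike.mem_coe.1 hVmem)
    refine Set.mem_iUnion.2 ⟨⟨w, hw⟩, ?_⟩
    change ‖((w.prod : Matrix.specialUnitaryGroup n ℂ) : Matrix n n ℂ) - (U : Matrix n n ℂ)‖ < ε₀
    rw [hprod, norm_sub_rev]
    exact hVU
  obtain ⟨T, hT⟩ := isCompact_univ.elim_finite_subcover c hopen hcover
  refine ⟨T.sup fun w => w.1.length, fun U => ?_⟩
  obtain ⟨w, hwT, hUw⟩ := Set.mem_iUnion₂.1 (hT (Set.mem_univ U))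
  refine ⟨w.1, w.2, ?_, le_of_lt hUw⟩
  exact Finset.le_sup (f := fun w : ι => w.1.length) hwT

end Literature.Computability.QuantumComplexity.SolovayKitaev
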